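import Summits.QuantumFields.GaugeBoot.DiagonalRPTorusHexDiagrams
import Summits.QuantumFields.GaugeBoot.DiagonalRPTorusHexShape
import Summits.QuantumFields.GaugeBoot.DiagonalRPTorusReplicaMoments
import HarnessLib

/-!
# The annulus constant of the bent-hexagon pair (gauge-boot, L3 `d = 3` uniform window, J2 brick 7)

HONEST FRAMING (cell `pub-gaugeboot`, page 1 of every file): the venture produces certified bounds
on lattice expectations at stated coupling, gauge group, dimension and torus size; NOT a mass gap,
NOT a continuum limit, NOT a string tension; NOT Yang–Mills-summit-bearing (barriers
`FixedCouplingUltralocality`, `PerturbativeInvisibility`). This module is bookkeeping for a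
structural NEGATIVE result (a coupling window UNIFORM in the torus size for the failure of
inner-half diagonal reflection positivity on `(ℤ/L)^3`, plan note
`HOME/pub-gaugeboot-lean3/gen46/D3-UNIFORM-PLAN.md` §3 item 6c (J2)); it proves no window.

## Content (torus `(ℤ/L)^3`, `L = 2c`, `c ≥ 15`, base `y` with `δ(y) = c - 1`, compact metrisable
`G`, continuous `ρ` with centre element `ρ z₀ = ω • 1`, `ω ≠ 1`, and (R1) with constant `c₁`)

With `hexF = Re χ(W_{θγ})` (word `thexW` from `y + 2e₀`) and `hexG = Re χ(W_{γ_y})`: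

* `plaqProd_Pt`, `integral_hexFG_plaqProd` — the moments `E[hexF · hexG · ∏_{q ∈ B} Re χ(U_q)]`
  over sub-families `B` of the annulus are word-list integrals of brick 3 in the chart;
* ★ `integral_hexF_plaqProd_eq_zero`, `integral_hexG_plaqProd_eq_zero`,
  `integral_hexFG_plaqProd_eq_zero` — the lonely-link VANISHING of every proper sub-diagram
  (brick 6 `hasLonely_*` + brick 3);
* ★★ **`integral_hexFG_plaqProd_hexTube : E[hexF · hexG · ∏_{annulus} Re χ(U_q)] = c₁^{11} N`**
  (brick 6 `runOps_annulus` + brick 3);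
* ★★ **`replicaTerm_hexTube_jet`** — `replicaTerm hexF hexG (annulus) z = 2 c₁^{11} N z^{10} + O(z^{11})`
  (bricks 4 + 5), hence with (J1) (`sum_replicaTerm_small_eq_hexTube`) the near-pair jet
  `τ₁₀ = c₁^{11} N > 0` of the plan note — assembled into the window in brick 8.

Elementary given the bricks; no named fact.
-/

open MeasureTheory Finset Function Filter Asymptotics
open scoped Topology

namespace Summit.QuantumFields.GaugeBoot

open Literature.MathematicalPhysics.QuantumFieldTheory
open Literature.MathematicalPhysics.QuantumFieldTheory.PlaquetteLowerBound (reTr continuous_reTr)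

noncomputable section

namespace DiagRPHex

open DiagRPTube DiagRPUnif

variable {L : ℕ} [NeZero L] {N : ℕ} {G : Type*} [Group G] [TopologicalSpace G]
  [IsTopologicalGroup G] [CompactSpace G] [MeasurableSpace G] [BorelSpace G]
  [SecondCountableTopology G] (ρ : G →* Matrix (Fin N) (Fin N) ℂ) (y : Site 3 L)

/-! ## The two hexagon observables -/

/-- `hexF = Re χ(W_{θγ})`: the mirror-image hexagon word read from `y + 2e₀`. -/
def hexF (U : GaugeConfig 3 L G) : ℝ := reTr ρ (wordHolonomy U (site y (2, 0, 0)) thexW)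

/-- `hexG = Re χ(W_{γ_y})`: the bent hexagon word read from `y`. -/
def hexG (U : GaugeConfig 3 L G) : ℝ := reTr ρ (wordHolonomy U (site y (0, 0, 0)) hexW)

omit [NeZero L] [MeasurableSpace G] [BorelSpace G] [SecondCountableTopology G] [CompactSpace G] in
/-- Word observables are continuous. -/
theorem continuous_reTr_wordHolonomy (hρ : Continuous ρ) (x : Site 3 L) (w : Word 3) :
    Continuous fun U : GaugeConfig 3 L G => reTr ρ (wordHolonomy U x w) := by
  have h := continuous_wlProd (G := G) ρ hρ [(x, w)]
  have : wlProd (G := G) ρ [(x, w)] = fun U => reTr ρ (wordHolonomy U x w) := by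
    funext U; simp [wlProd]
  rwa [this] at h

omit [NeZero L] [MeasurableSpace G] [BorelSpace G] [SecondCountableTopology G] in
/-- `|Re χ| ≤ N` along any word. -/
theorem abs_reTr_wordHolonomy_le (hρ : Continuous ρ) (x : Site 3 L) (w : Word 3) (U : GaugeConfig 3 L G) :
    |reTr ρ (wordHolonomy U x w)| ≤ N := by
  unfold reTr
  simpa using Literature.RepresentationTheory.CompactGroups.CompactGroup.abs_re_trace_le_card ρ hρ
    (wordHolonomy U x w)

/-! ## Moments over sub-families of the annulus are charted word-list integrals -/

omit [NeZero L] [MeasurableSpace G] [BorelSpace G] [SecondCountableTopology G] [TopologicalSpace G]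
  [IsTopologicalGroup G] [CompactSpace G] in
/-- A charted plaquette value is the character of the plaquette word. -/
theorem plaqRe_plaq (p : LPlaq) (U : GaugeConfig 3 L G) :
    WilsonRP.plaqRe ρ U (plaq y p) = reTr ρ (wordHolonomy U (site y p.1) (pword p.2)) := by
  rw [pword, wordHolonomy_plaquette, WilsonRP.plaqRe, reTr, plaq, plane_fst, plane_snd]

omit [NeZero L] [MeasurableSpace G] [BorelSpace G] [SecondCountableTopology G] [TopologicalSpace G]
  [IsTopologicalGroup G] [CompactSpace G] in
/-- The word-list product of plaquette words is the product of plaquette values. -/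
theorem wlProd_wordsOf (S : List LPlaq) (U : GaugeConfig 3 L G) :
    wlProd ρ (chartWords y (wordsOf S)) U = ((S.map (plaq y)).map fun q => WilsonRP.plaqRe ρ U q).prod := by
  induction S with
  | nil => simp [wlProd, chartWords, wordsOf]
  | cons p S ih =>
    have h : chartWords y (wordsOf (p :: S)) = (site y p.1, pword p.2) :: chartWords y (wordsOf S) := rfl
    rw [h, wlProd_cons, ih]
    simp [plaqRe_plaq]

omit [NeZero L] [MeasurableSpace G] [BorelSpace G] [SecondCountableTopology G] [TopologicalSpace G]
  [IsTopologicalGroup G] [CompactSpace G] in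
/-- ★ `∏_{q ∈ Pt S} Re χ(U_q)` is the word-list product of the plaquette words (no repetitions). -/
theorem plaqProd_Pt {S : List LPlaq} (hS : (S.map (plaq y)).Nodup) (U : GaugeConfig 3 L G) :
    plaqProd ρ (Pt y S) U = wlProd ρ (chartWords y (wordsOf S)) U := by
  classical
  rw [wlProd_wordsOf, plaqProd, Pt, List.prod_toFinset _ hS]

omit [SecondCountableTopology G] in
/-- ★ The mixed moment over a sub-family is a word-list integral. -/
theorem integral_hexFG_plaqProd {S : List LPlaq} (hS : (S.map (plaq y)).Nodup) :
    ∫ V, hexF ρ y V * hexG ρ y V * plaqProd ρ (Pt y S) V ∂Measure.pi (fun _ : Edge 3 L => haarProbability G) =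
      wlInt ρ (chartWords y (fWord :: gWord :: wordsOf S)) := by
  unfold wlInt
  refine integral_congr_ae (ae_of_all _ fun V => ?_)
  rw [chartWords_cons, chartWords_cons, wlProd_cons, wlProd_cons, ← plaqProd_Pt ρ y hS]
  simp only [hexF, hexG, fWord, gWord, mul_assoc]

omit [SecondCountableTopology G] in
/-- The `hexF` moment over a sub-family is a word-list integral. -/
theorem integral_hexF_plaqProd {S : List LPlaq} (hS : (S.map (plaq y)).Nodup) :
    ∫ V, hexF ρ y V * plaqProd ρ (Pt y S) V ∂Measure.pi (fun _ : Edge 3 L => haarProbability G) =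
      wlInt ρ (chartWords y (fWord :: wordsOf S)) := by
  unfold wlInt
  refine integral_congr_ae (ae_of_all _ fun V => ?_)
  rw [chartWords_cons, wlProd_cons, ← plaqProd_Pt ρ y hS]
  simp only [hexF, fWord]

omit [SecondCountableTopology G] in
/-- The `hexG` moment over a sub-family is a word-list integral. -/
theorem integral_hexG_plaqProd {S : List LPlaq} (hS : (S.map (plaq y)).Nodup) :
    ∫ V, hexG ρ y V * plaqProd ρ (Pt y S) V ∂Measure.pi (fun _ : Edge 3 L => haarProbability G) =
      wlInt ρ (chartWords y (gWord :: wordsOf S)) := by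
  unfold wlInt
  refine integral_congr_ae (ae_of_all _ fun V => ?_)
  rw [chartWords_cons, wlProd_cons, ← plaqProd_Pt ρ y hS]
  simp only [hexG, gWord]

/-! ## Sub-families of the annulus -/

omit [NeZero L] in
/-- A sublist of the annulus charts without repetition (`L > 8`). -/
theorem nodup_map_plaq (hL : 8 < L) {S : List LPlaq} (hS : S.Sublist tubeT) : (S.map (plaq y)).Nodup := by
  have hnd : tubeT.Nodup := by decide +kernel
  refine (hS.nodup hnd).map_on fun p hp p' hp' h => ?_
  exact plaq_injOn y (by omega) (inBox_tubeT p (hS.subset hp)) (inBox_tubeT p' (hS.subset hp')) h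

omit [NeZero L] in
/-- ★ Every sub-family of the annulus is charted by a sublist of `tubeT`. -/
theorem exists_sublist_of_subset_hexTube {B : Finset (Plaquette 3 L)} (hB : B ⊆ hexTube y) :
    ∃ S : List LPlaq, S.Sublist tubeT ∧ B = Pt y S := by
  classical
  refine ⟨tubeT.filter fun p => plaq y p ∈ B, List.filter_sublist, ?_⟩
  ext q
  simp only [mem_Pt, List.mem_filter, decide_eq_true_eq]
  constructor
  · intro hq
    obtain ⟨p, hp, rfl⟩ := mem_Pt.1 (hB hq)
    exact ⟨p, ⟨hp, hq⟩, rfl⟩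
  · rintro ⟨p, ⟨-, hp⟩, rfl⟩; exact hp

/-! ## Vanishing of the proper sub-diagrams -/

section Vanishing

variable {ρ y} (hL : 8 < L) (hρ : Continuous ρ) {z₀ : G} {ω : ℂ}
  (hz₀ : ρ z₀ = ω • (1 : Matrix (Fin N) (Fin N) ℂ)) (hω : ω ≠ 1)
include hL hρ hz₀ hω

/-- ★ `E[hexF · ∏_{q ∈ B} Re χ(U_q)] = 0` for every sub-family `B` of the annulus. -/
theorem integral_hexF_plaqProd_eq_zero {B : Finset (Plaquette 3 L)} (hB : B ⊆ hexTube y) :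
    ∫ V, hexF ρ y V * plaqProd ρ B V ∂Measure.pi (fun _ : Edge 3 L => haarProbability G) = 0 := by
  obtain ⟨S, hS, rfl⟩ := exists_sublist_of_subset_hexTube y hB
  rw [integral_hexF_plaqProd ρ y (nodup_map_plaq y hL hS)]
  exact wlInt_eq_zero_of_hasLonely ρ y (B := 4) (by omega) hρ hz₀ hω
    (hasLonely_f S (List.mem_sublists.2 hS))

/-- ★ `E[hexG · ∏_{q ∈ B} Re χ(U_q)] = 0` for every sub-family `B` of the annulus. -/
theorem integral_hexG_plaqProd_eq_zero {B : Finset (Plaquette 3 L)} (hB : B ⊆ hexTube y) :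
    ∫ V, hexG ρ y V * plaqProd ρ B V ∂Measure.pi (fun _ : Edge 3 L => haarProbability G) = 0 := by
  obtain ⟨S, hS, rfl⟩ := exists_sublist_of_subset_hexTube y hB
  rw [integral_hexG_plaqProd ρ y (nodup_map_plaq y hL hS)]
  exact wlInt_eq_zero_of_hasLonely ρ y (B := 4) (by omega) hρ hz₀ hω
    (hasLonely_g S (List.mem_sublists.2 hS))

/-- ★ `E[hexF · hexG · ∏_{q ∈ B} Re χ(U_q)] = 0` for every PROPER sub-family `B` of the annulus. -/
theorem integral_hexFG_plaqProd_eq_zero {B : Finset (Plaquette 3 L)} (hB : B ⊆ hexTube y)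
    (hne : B ≠ hexTube y) :
    ∫ V, hexF ρ y V * hexG ρ y V * plaqProd ρ B V ∂Measure.pi (fun _ : Edge 3 L => haarProbability G) = 0 := by
  obtain ⟨S, hS, rfl⟩ := exists_sublist_of_subset_hexTube y hB
  rw [integral_hexFG_plaqProd ρ y (nodup_map_plaq y hL hS)]
  refine wlInt_eq_zero_of_hasLonely ρ y (B := 4) (by omega) hρ hz₀ hω
    (hasLonely_fg S (List.mem_sublists.2 hS) fun h => hne ?_)
  rw [h]; rfl

end Vanishing

/-! ## The annulus constant and the jet -/

/-- ★★ **THE ANNULUS CONSTANT**: `E[hexF · hexG · ∏_{q ∈ annulus} Re χ(U_q)] = c₁^{11} · N`. -/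
theorem integral_hexFG_plaqProd_hexTube (hL : 8 < L) (hρ : Continuous ρ) {c₁ : ℝ}
    (hR1 : ∀ x z : G, ∫ g, reTr ρ (x * g⁻¹) * reTr ρ (g * z) ∂haarProbability G = c₁ * reTr ρ (x * z)) :
    ∫ V, hexF ρ y V * hexG ρ y V * plaqProd ρ (hexTube y) V ∂Measure.pi (fun _ : Edge 3 L => haarProbability G) =
      c₁ ^ 11 * N := by
  have h := integral_hexFG_plaqProd ρ y (nodup_map_plaq y hL (List.Sublist.refl tubeT))
  rw [hexTube, h, wlInt_eq_of_runOps ρ y (B := 4) (by omega) hρ hR1 _ _ runOps_annulus, pow_one]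

/-- ★ The jet coefficient of the annulus: `jetCoeff hexF hexG annulus = 2 c₁^{11} N`. -/
theorem jetCoeff_hexTube (hL : 8 < L) (hρ : Continuous ρ) {z₀ : G} {ω : ℂ}
    (hz₀ : ρ z₀ = ω • (1 : Matrix (Fin N) (Fin N) ℂ)) (hω : ω ≠ 1) {c₁ : ℝ}
    (hR1 : ∀ x z : G, ∫ g, reTr ρ (x * g⁻¹) * reTr ρ (g * z) ∂haarProbability G = c₁ * reTr ρ (x * z)) :
    jetCoeff ρ (hexF ρ y) (hexG ρ y) (hexTube y) = 2 * (c₁ ^ 11 * N) := by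
  rw [← integral_hexFG_plaqProd_hexTube ρ y hL hρ hR1]
  exact jetCoeff_eq_two_mul ρ hρ (continuous_reTr_wordHolonomy ρ hρ _ _).measurable
    (continuous_reTr_wordHolonomy ρ hρ _ _).measurable (abs_reTr_wordHolonomy_le ρ hρ _ _)
    (abs_reTr_wordHolonomy_le ρ hρ _ _) (hexTube y)
    (fun B hB => integral_hexF_plaqProd_eq_zero hL hρ hz₀ hω hB)
    (fun B hB => integral_hexG_plaqProd_eq_zero hL hρ hz₀ hω hB)
    (fun B hB hne => integral_hexFG_plaqProd_eq_zero hL hρ hz₀ hω hB hne)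

/-- ★★ **THE JET OF THE ANNULUS TERM**:
`replicaTerm hexF hexG (annulus) z - 2 c₁^{11} N z^{10} = O(z^{11})` at `z = 0`. -/
theorem replicaTerm_hexTube_jet (hL : 8 < L) (hρ : Continuous ρ) {z₀ : G} {ω : ℂ}
    (hz₀ : ρ z₀ = ω • (1 : Matrix (Fin N) (Fin N) ℂ)) (hω : ω ≠ 1) {c₁ : ℝ}
    (hR1 : ∀ x z : G, ∫ g, reTr ρ (x * g⁻¹) * reTr ρ (g * z) ∂haarProbability G = c₁ * reTr ρ (x * z)) :
    (fun z => replicaTerm ρ (hexF ρ y) (hexG ρ y) (hexTube y) z - ((2 * (c₁ ^ 11 * N) : ℝ) : ℂ) * z ^ 10)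
      =O[𝓝 (0 : ℂ)] fun z => z ^ 11 := by
  have h := replicaTerm_jet ρ hρ (continuous_reTr_wordHolonomy ρ hρ _ _).measurable
    (continuous_reTr_wordHolonomy ρ hρ _ _).measurable (abs_reTr_wordHolonomy_le ρ hρ _ _)
    (abs_reTr_wordHolonomy_le ρ hρ _ _) (hexTube y) (f := hexF ρ y) (g := hexG ρ y)
  rw [card_hexTube (y := y) hL, jetCoeff_hexTube ρ y hL hρ hz₀ hω hR1] at h
  exact h

end DiagRPHex

end

end Summit.QuantumFields.GaugeBoot
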